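import Literature.NumberTheory.Sieve.PolymathMkEpsJ
import HarnessLib

/-!
# Polymath 8b §7.2: `I(F)` and `J_{i,1-ε}(F)` of the symmetric-polynomial test functions as exact finite sums

Topic `Literature/NumberTheory/Sieve`; fourth support file behind the numerical leaf (Theorem 3.13(i),
`M_{50,1/25} > 4`) of `Literature.NumberTheory.Sieve.frequently_nth_prime_succ_le_add_polymath`.

The test functions of Polymath 8b §7.2 are `F = 1_{(1+ε)·R_k} · Q` with
`Q = ∑_i q_i(1 + ε − P₁) · ∏_p p_{v_p}^{ν_{i,p}}`, `q_i` polynomials, `p_v = ∑_l t_l^v` power sums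
(we use products of even power sums in place of the monomial symmetric polynomials `P_α`, `α` even,
of the paper: the same linear span, but closed under products, so that only the moments of
`PolymathMkEpsIntegrals.lean` are needed and no structure constants).  This file turns both
functionals of Theorem 3.12 into explicit finite sums of rational numbers (given rational data):

* `MkEps.qPoly` — the polynomial `Q` (data: parts `v`, vectors `ν i`, coefficients `A i a`, `a ≤ D`).
* `MkEps.ival`, `MkEps.iForm`, `MkEps.integral_scaledSimplex_qPoly_sq` — `∫_{r·R_K} Q² = iForm`
  (a double sum of the moments `integral_scaledSimplex_psMoment`).
* `MkEps.gPoly`, `MkEps.intervalIntegral_qPoly_insertNth` — the inner integral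
  `∫₀^{r−∑s} Q(insertNth m u s) du = G(s)`, a polynomial of the same shape in `k − 1` variables
  (index set `gIndex`: triples `(i, j ≤ ν_i, a)`).
* `MkEps.mom`, `MkEps.jForm`, `MkEps.integral_scaledSimplex_gPoly_sq` — `∫_{ρ·R_n} G² = jForm`
  (moments `integral_scaledSimplex_shifted_psMoment`).
* `MkEps.polymathI_cutoff`, `MkEps.polymathJ_cutoff`, `MkEps.polymathFunctional_cutoff` — hence
  `I(F) = iForm`, `J_{m,1−ε}(F) = jForm` for every `m`, and the functional of Theorem 3.12 equals
  `k · jForm / iForm`.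
* `MkEps.exists_gt_of_forms` — **the certificate criterion**: if `0 < iForm` and
  `M · iForm < k · jForm` then some test function has `(∑ J)/I > M`; with `k = 50`, `M = 4` this is the
  shape consumed by `frequently_nth_prime_succ_le_add_polymath_of_exists_gt_four`.

The evaluation of `iForm`, `jForm` in exact integer arithmetic for the actual degree-25 data is the
business of the next file.

## References
* [Polymath8b2014] D. H. J. Polymath, *Variants of the Selberg sieve, and bounded intervals
  containing many primes*, Res. Math. Sci. 1 (2014), Art. 12 = arXiv:1407.4897, §7.2 and Lemma 7.2.
-/

open MeasureTheory Set Filter Finset intervalIntegral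
open scoped BigOperators

noncomputable section

namespace Literature.NumberTheory.Sieve

namespace MkEps

variable {P : ℕ} {ι : Type*} [Fintype ι]

/-! ### The data and the polynomial `Q` -/

/-- The box `{j : j ≤ c}` of sub-multiplicity vectors. [folklore] -/
def box (c : Fin P → ℕ) : Finset (Fin P → ℕ) := Fintype.piFinset fun p => Finset.range (c p + 1)

/-- Members of `box c` are `≤ c`. [folklore] -/
theorem le_of_mem_box {c j : Fin P → ℕ} (hj : j ∈ box c) (p : Fin P) : j p ≤ c p :=
  le_of_mem_piFinset_range hj p

/-- The index set of `Q`: pairs `(i, a)` with `a ≤ D`. [folklore] -/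
def iIndex (ι : Type*) [Fintype ι] (D : ℕ) : Finset (ι × ℕ) := Finset.univ ×ˢ Finset.range (D + 1)

/-- The test polynomial of Polymath 8b §7.2 in the power-sum basis:
`Q(t) = ∑_i ∑_{a ≤ D} A_{i,a} (r − P₁(t))^a ∏_p p_{v_p}(t)^{ν_{i,p}}` (`r = 1 + ε`). [cite: Polymath8b2014, §7.2] -/
def qPoly {k : ℕ} (v : Fin P → ℕ) (r : ℝ) (D : ℕ) (A : ι → ℕ → ℝ) (ν : ι → Fin P → ℕ)
    (t : Fin k → ℝ) : ℝ :=
  ∑ x ∈ iIndex ι D, A x.1 x.2 * ((r - ∑ l, t l) ^ x.2 * psProd v (ν x.1) t)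

/-- `Q` is continuous. [folklore] -/
theorem continuous_qPoly {k : ℕ} (v : Fin P → ℕ) (r : ℝ) (D : ℕ) (A : ι → ℕ → ℝ) (ν : ι → Fin P → ℕ) :
    Continuous (qPoly (k := k) v r D A ν) := by
  unfold qPoly
  refine continuous_finsetSum _ fun x _ => continuous_const.mul ?_
  exact (by fun_prop : Continuous fun t : Fin k → ℝ => (r - ∑ l, t l) ^ x.2).mul (continuous_psProd v _)

/-! ### `I(F)`: the moments over the enlarged simplex -/

/-- `Ival(A, c) = ∫_{r·R_K} (r − P₁)^A ∏ p^c = r^{K+A+deg} A! S_K(c)/(K+A+deg)!`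
(`integral_scaledSimplex_psMoment`). [cite: Polymath8b2014, §7.2] -/
def ival (v : Fin P → ℕ) (K : ℕ) (r : ℝ) (A : ℕ) (c : Fin P → ℕ) : ℝ :=
  r ^ (K + A + psDeg v c) * (((A.factorial * dSgen v K c : ℕ) : ℝ) / (K + A + psDeg v c).factorial)

/-- The quadratic form `I(F) = ∑_{(i,a),(i',a')} A_{i,a} A_{i',a'} Ival(a + a', ν_i + ν_{i'})`. [cite: Polymath8b2014, §7.2] -/
def iForm (v : Fin P → ℕ) (K : ℕ) (r : ℝ) (D : ℕ) (A : ι → ℕ → ℝ) (ν : ι → Fin P → ℕ) : ℝ :=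
  ∑ x ∈ iIndex ι D, ∑ y ∈ iIndex ι D, A x.1 x.2 * A y.1 y.2 * ival v K r (x.2 + y.2) (ν x.1 + ν y.1)

/-- **`∫_{r·R_K} Q² = iForm`** (`r > 0`). [cite: Polymath8b2014, §7.2] -/
theorem integral_scaledSimplex_qPoly_sq {K : ℕ} (v : Fin P → ℕ) {r : ℝ} (hr : 0 < r) (D : ℕ)
    (A : ι → ℕ → ℝ) (ν : ι → Fin P → ℕ) :
    ∫ t in scaledSimplex K r, qPoly v r D A ν t ^ 2 = iForm v K r D A ν := by
  have hexp : ∀ t : Fin K → ℝ, qPoly v r D A ν t ^ 2 = ∑ x ∈ iIndex ι D, ∑ y ∈ iIndex ι D,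
      (A x.1 x.2 * A y.1 y.2) * ((r - ∑ l, t l) ^ (x.2 + y.2) * psProd v (ν x.1 + ν y.1) t) := by
    intro t
    rw [sq, qPoly, Finset.sum_mul_sum]
    refine Finset.sum_congr rfl fun x _ => Finset.sum_congr rfl fun y _ => ?_
    rw [pow_add, ← psProd_add]; ring
  simp_rw [hexp]
  have hint : ∀ x y : ι × ℕ, Integrable (fun t : Fin K → ℝ =>
      (A x.1 x.2 * A y.1 y.2) * ((r - ∑ l, t l) ^ (x.2 + y.2) * psProd v (ν x.1 + ν y.1) t))
      (volume.restrict (scaledSimplex K r)) := by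
    intro x y
    have hc : Continuous fun t : Fin K → ℝ =>
        (A x.1 x.2 * A y.1 y.2) * ((r - ∑ l, t l) ^ (x.2 + y.2) * psProd v (ν x.1 + ν y.1) t) :=
      continuous_const.mul ((by fun_prop : Continuous fun t : Fin K → ℝ => (r - ∑ l, t l) ^ (x.2 + y.2)).mul
        (continuous_psProd v _))
    exact hc.continuousOn.integrableOn_compact (isCompact_scaledSimplex _ _)
  rw [integral_finsetSum _ fun x _ => integrable_finsetSum _ fun y _ => hint x y]
  refine Finset.sum_congr rfl fun x _ => ?_
  rw [integral_finsetSum _ fun y _ => hint x y]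
  refine Finset.sum_congr rfl fun y _ => ?_
  rw [MeasureTheory.integral_const_mul, integral_scaledSimplex_psMoment v hr]
  rfl

/-! ### The inner integral `G` and `J(F)` -/

/-- The index set of `G`: triples `((i, j), a)` with `j ≤ ν_i`, `a ≤ D`. [folklore] -/
def gIndex (D : ℕ) (ν : ι → Fin P → ℕ) : Finset ((Σ _ : ι, Fin P → ℕ) × ℕ) :=
  (Finset.univ.sigma fun i => box (ν i)) ×ˢ Finset.range (D + 1)

/-- The coefficient of the `G`-monomial indexed by `((i,j),a)`:
`A_{i,a} · ∏_p C(ν_{i,p}, j_p) · a! e_j!/(a + e_j + 1)!`, `e_j = ∑_p v_p j_p`. [cite: Polymath8b2014, §7.2] -/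
def gCoef (v : Fin P → ℕ) (A : ι → ℕ → ℝ) (ν : ι → Fin P → ℕ) (x : (Σ _ : ι, Fin P → ℕ) × ℕ) : ℝ :=
  A x.1.1 x.2 * (∏ p, ((ν x.1.1 p).choose (x.1.2 p) : ℝ)) *
    (((x.2.factorial * (∑ p, v p * x.1.2 p).factorial : ℕ) : ℝ) / (x.2 + (∑ p, v p * x.1.2 p) + 1).factorial)

/-- The exponent `a + e_j + 1` of `r − P₁` in the `G`-monomial `((i,j),a)`. [folklore] -/
def gExp (v : Fin P → ℕ) (x : (Σ _ : ι, Fin P → ℕ) × ℕ) : ℕ := x.2 + (∑ p, v p * x.1.2 p) + 1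

/-- The multiplicity vector `ν_i − j` of the `G`-monomial `((i,j),a)`. [folklore] -/
def gVec (ν : ι → Fin P → ℕ) (x : (Σ _ : ι, Fin P → ℕ) × ℕ) : Fin P → ℕ := ν x.1.1 - x.1.2

/-- `G(s) = ∑_{((i,j),a)} gCoef · (r − P₁(s))^{a+e_j+1} ∏_p p_{v_p}(s)^{ν_{i,p} − j_p}`, the inner
integral `∫₀^{r − ∑ s} Q du` as a polynomial in the remaining `n = k − 1` variables. [cite: Polymath8b2014, §7.2] -/
def gPoly {n : ℕ} (v : Fin P → ℕ) (r : ℝ) (D : ℕ) (A : ι → ℕ → ℝ) (ν : ι → Fin P → ℕ)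
    (s : Fin n → ℝ) : ℝ :=
  ∑ x ∈ gIndex D ν, gCoef v A ν x * ((r - ∑ l, s l) ^ gExp v x * psProd v (gVec ν x) s)

/-- **The inner integral**: `∫₀^{r − ∑ s} Q(insertNth m u s) du = G(s)` for every place `m`
(`intervalIntegral_sub_pow_mul_psProd` termwise). [cite: Polymath8b2014, §7.2] -/
theorem intervalIntegral_qPoly_insertNth {n : ℕ} (v : Fin P → ℕ) (r : ℝ) (D : ℕ) (A : ι → ℕ → ℝ)
    (ν : ι → Fin P → ℕ) (m : Fin (n + 1)) (s : Fin n → ℝ) :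
    ∫ u in (0:ℝ)..(r - ∑ i, s i), qPoly v r D A ν (Fin.insertNth m u s) = gPoly v r D A ν s := by
  unfold qPoly
  simp_rw [sub_sum_insertNth]
  rw [intervalIntegral.integral_finsetSum fun x _ => ?_]
  · simp_rw [intervalIntegral.integral_const_mul, intervalIntegral_sub_pow_mul_psProd, Finset.mul_sum]
    -- reindex `∑_{(i,a)} ∑_{j ≤ ν i}` as `∑_{((i,j),a)}`
    rw [gPoly, gIndex, Finset.sum_product, iIndex, Finset.sum_product, Finset.sum_sigma]
    refine Finset.sum_congr rfl fun i _ => ?_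
    rw [Finset.sum_comm]
    refine Finset.sum_congr rfl fun j _ => Finset.sum_congr rfl fun a _ => ?_
    simp only [gCoef, gExp, gVec]
    ring
  · exact (((continuous_const.sub continuous_id).pow _).mul
      ((continuous_psProd v _).comp (by fun_prop))).intervalIntegrable _ _ |>.const_mul _

/-- `Mom(E, c) = ∫_{ρ·R_n} (r − P₁)^E ∏ p^c
  = ρ^{n+deg} ∑_{B ≤ E} C(E,B) (r − ρ)^{E−B} ρ^B B! S_n(c)/(n + B + deg)!`
(`integral_scaledSimplex_shifted_psMoment`). [cite: Polymath8b2014, §7.2] -/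
def mom (v : Fin P → ℕ) (n : ℕ) (ρ r : ℝ) (E : ℕ) (c : Fin P → ℕ) : ℝ :=
  ρ ^ (n + psDeg v c) * ∑ B ∈ Finset.range (E + 1), (E.choose B : ℝ) * (r - ρ) ^ (E - B) * ρ ^ B *
    (((B.factorial * dSgen v n c : ℕ) : ℝ) / (n + B + psDeg v c).factorial)

/-- The quadratic form `J = ∑_{x,y} gCoef(x) gCoef(y) Mom(gExp x + gExp y, gVec x + gVec y)`. [cite: Polymath8b2014, §7.2] -/
def jForm (v : Fin P → ℕ) (n : ℕ) (ρ r : ℝ) (D : ℕ) (A : ι → ℕ → ℝ) (ν : ι → Fin P → ℕ) : ℝ :=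
  ∑ x ∈ gIndex D ν, ∑ y ∈ gIndex D ν,
    gCoef v A ν x * gCoef v A ν y * mom v n ρ r (gExp v x + gExp v y) (gVec ν x + gVec ν y)

/-- **`∫_{ρ·R_n} G² = jForm`** (`ρ > 0`). [cite: Polymath8b2014, §7.2] -/
theorem integral_scaledSimplex_gPoly_sq {n : ℕ} (v : Fin P → ℕ) {ρ : ℝ} (hρ : 0 < ρ) (r : ℝ) (D : ℕ)
    (A : ι → ℕ → ℝ) (ν : ι → Fin P → ℕ) :
    ∫ s in scaledSimplex n ρ, gPoly v r D A ν s ^ 2 = jForm v n ρ r D A ν := by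
  have hexp : ∀ s : Fin n → ℝ, gPoly v r D A ν s ^ 2 = ∑ x ∈ gIndex D ν, ∑ y ∈ gIndex D ν,
      (gCoef v A ν x * gCoef v A ν y) *
        ((r - ∑ l, s l) ^ (gExp v x + gExp v y) * psProd v (gVec ν x + gVec ν y) s) := by
    intro s
    rw [sq, gPoly, Finset.sum_mul_sum]
    refine Finset.sum_congr rfl fun x _ => Finset.sum_congr rfl fun y _ => ?_
    rw [pow_add, ← psProd_add]; ring
  simp_rw [hexp]
  have hint : ∀ x y : (Σ _ : ι, Fin P → ℕ) × ℕ, Integrable (fun s : Fin n → ℝ =>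
      (gCoef v A ν x * gCoef v A ν y) *
        ((r - ∑ l, s l) ^ (gExp v x + gExp v y) * psProd v (gVec ν x + gVec ν y) s))
      (volume.restrict (scaledSimplex n ρ)) := by
    intro x y
    have hc : Continuous fun s : Fin n → ℝ => (gCoef v A ν x * gCoef v A ν y) *
        ((r - ∑ l, s l) ^ (gExp v x + gExp v y) * psProd v (gVec ν x + gVec ν y) s) :=
      continuous_const.mul ((by fun_prop : Continuous fun s : Fin n → ℝ =>
        (r - ∑ l, s l) ^ (gExp v x + gExp v y)).mul (continuous_psProd v _))
    exact hc.continuousOn.integrableOn_compact (isCompact_scaledSimplex _ _)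
  rw [integral_finsetSum _ fun x _ => integrable_finsetSum _ fun y _ => hint x y]
  refine Finset.sum_congr rfl fun x _ => ?_
  rw [integral_finsetSum _ fun y _ => hint x y]
  refine Finset.sum_congr rfl fun y _ => ?_
  rw [MeasureTheory.integral_const_mul, integral_scaledSimplex_shifted_psMoment v hρ]
  rfl

/-! ### The functionals of Theorem 3.12 for `F = 1_{(1+ε)·R_k} · Q` -/

/-- `I(1_{r·R_K} Q) = iForm` (`r > 0`). [cite: Polymath8b2014, §7.2] -/
theorem polymathI_cutoff {K : ℕ} (v : Fin P → ℕ) {r : ℝ} (hr : 0 < r) (D : ℕ) (A : ι → ℕ → ℝ)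
    (ν : ι → Fin P → ℕ) :
    polymathI K ((scaledSimplex K r).indicator (qPoly v r D A ν)) = iForm v K r D A ν := by
  rw [polymathI_indicator_eq, integral_scaledSimplex_qPoly_sq v hr]

/-- `J_{m,ρ}(1_{r·R_{n+1}} Q) = jForm` for every place `m` (`0 < ρ ≤ r`). [cite: Polymath8b2014, §7.2] -/
theorem polymathJ_cutoff {n : ℕ} (v : Fin P → ℕ) {ρ r : ℝ} (hρ : 0 < ρ) (hρr : ρ ≤ r) (D : ℕ)
    (A : ι → ℕ → ℝ) (ν : ι → Fin P → ℕ) (m : Fin (n + 1)) :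
    polymathJ (n + 1) ρ m ((scaledSimplex (n + 1) r).indicator (qPoly v r D A ν)) =
      jForm v n ρ r D A ν := by
  rw [polymathJ_indicator_eq hρr]
  simp_rw [intervalIntegral_qPoly_insertNth]
  exact integral_scaledSimplex_gPoly_sq v hρ r D A ν

/-- **The functional of Theorem 3.12 in closed form**: for `0 < ε < 1` and `F = 1_{(1+ε)·R_{n+1}} Q`,
`(∑_m J_{m,1−ε}(F)) / I(F) = (n+1) · jForm / iForm`. [cite: Polymath8b2014, §7.2] -/
theorem polymathFunctional_cutoff {n : ℕ} (v : Fin P → ℕ) {ε : ℝ} (hε : 0 < ε) (hε1 : ε < 1) (D : ℕ)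
    (A : ι → ℕ → ℝ) (ν : ι → Fin P → ℕ) :
    polymathFunctional (n + 1) ε ((scaledSimplex (n + 1) (1 + ε)).indicator (qPoly v (1 + ε) D A ν)) =
      ((n + 1 : ℕ) : ℝ) * jForm v n (1 - ε) (1 + ε) D A ν / iForm v (n + 1) (1 + ε) D A ν := by
  rw [polymathFunctional, polymathI_cutoff v (by linarith) D A ν]
  congr 1
  rw [Finset.sum_congr rfl fun m _ => polymathJ_cutoff v (by linarith) (by linarith) D A ν m,
    Finset.sum_const, Finset.card_univ, Fintype.card_fin, nsmul_eq_mul]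

/-- **The certificate criterion** (Polymath 8b §7.2, "we then do the quick (and exact) arithmetic to
verify that (7.4) holds for some constant `C > 4`"): if the exact quadratic forms of the data satisfy
`iForm > 0` and `M · iForm < (n+1) · jForm` (`r = 1+ε`, `ρ = 1−ε`, `0 < ε < 1`), then
`F = 1_{(1+ε)·R_{n+1}} Q` is a test function of Theorem 3.12 with `(∑_m J_{m,1−ε}(F))/I(F) > M`.
[cite: Polymath8b2014, §7.2] -/
theorem exists_gt_of_forms {n : ℕ} (v : Fin P → ℕ) {ε : ℝ} (hε : 0 < ε) (hε1 : ε < 1) (D : ℕ)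
    (A : ι → ℕ → ℝ) (ν : ι → Fin P → ℕ) {M : ℝ}
    (hpos : 0 < iForm v (n + 1) (1 + ε) D A ν)
    (hlt : M * iForm v (n + 1) (1 + ε) D A ν < ((n + 1 : ℕ) : ℝ) * jForm v n (1 - ε) (1 + ε) D A ν) :
    ∃ F : (Fin (n + 1) → ℝ) → ℝ, IsPolymathTestFunction (n + 1) ε F ∧ M < polymathFunctional (n + 1) ε F := by
  refine ⟨(scaledSimplex (n + 1) (1 + ε)).indicator (qPoly v (1 + ε) D A ν), ?_, ?_⟩
  · refine isPolymathTestFunction_indicator (continuous_qPoly v _ D A ν) ?_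
    rwa [integral_scaledSimplex_qPoly_sq v (by linarith)]
  · rw [polymathFunctional_cutoff v hε hε1, lt_div_iff₀ hpos]
    exact hlt

end MkEps

end Literature.NumberTheory.Sieve
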